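import Literature.AlgebraicGeometry.HodgeTheory.VHSDataHodgeLocusOverPuncturedCompactCurve
import Literature.AlgebraicGeometry.Motives.FamiliesVHSComap
import Literature.AlgebraicGeometry.Motives.FamiliesVHSComapCovering
import HarnessLib

/-!
# Cattani–Deligne–Kaplan, Theorem 1.1 / Cor. 1.3 over a curve AFTER PASSING TO A FINITE (ÉTALE) COVER: if the pulled-back variation `f* 𝒱` on
# a cover `S' ↠ S` has the unipotent period charts of the one-variable theorem, the Hodge locus and the determination locus of `𝒱` on `S` are
# ALL of `S` or FINITE

Topic `Literature/AlgebraicGeometry/HodgeTheory` (namespace `Literature.AlgebraicGeometry.Motives.VHSData`), lane `lit-hodgefound` (seat `p08`,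
row g55-#8).  THEOREMS ONLY (no definition, no named fact, no instance; D-0026 net debt `0`).  JUNCTION of `Motives/FamiliesVHSComap`
(`VHSData.comap`, `hodgeLocusOfNormLe_eq_univ_or_finite_of_comap`) and the one-dimensional CDK theorems of `HodgeTheory/VHSDataHodgeLocusOverCurve`, `…/VHSDataHodgeLocusOverPuncturedCompactCurve`.

PRINTED SOURCE, VERBATIM (E. Cattani, P. Deligne, A. Kaplan, *On the locus of Hodge classes*, J. AMS 8 (1995), p. 485; held text
`paper:arxiv-alg-geom_9402009` p0002): «Proof of 1.5 ⟹ 1.1: To prove 1.1 one is free to replace `S` of 1.1 by a finite etale covering `S' → S`. We may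
and shall assume that the monodromy mod `k` of `𝒱` is trivial, for some `k ≥ 3`.  Let `S̄` be a smooth compactification of `S`, with `S̄ − S` a divisor
with normal crossings. The assumption on the monodromy ensures that the local monodromy of `𝒱` at infinity is unipotent: in a neighborhood of any
point in `S̄ − S`, one is in the situation considered in 1.5. … By GAGA, `S̄^{(K)}`, finite over `S̄`, is algebraic, and 1.1 follows.»

THE SHAPE.  `D : VHSData S k`; `f : C(S', S)` SURJECTIVE; the period charts of the
one-variable theorem are assumed FOR THE PULL-BACK `f* D = D.comap f` ON `S'` (interior charts at every point of `S'`; puncture charts with UNIPOTENT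
local monodromy — this is where the cover is used —; open ends and compact core on `S'`, abstractly or from a compactification `S' ↪ X` with disc
charts).  Conclusion ON `S`: `hodgeLocusOfNormLe D p K` (resp. the determination locus of `u₀`) is all of `S` or finite, because it is the image under
`f` of the corresponding locus of `f* D` (`Z(f* D) = f⁻¹ Z(D)`, resp. path lifting).
* §1 **`hodgeLocusOfNormLe_eq_univ_or_finite_of_cover`** — THM 1.1 ∕ COR 1.2 (`r = 1`) with the abstract ends∕core on the cover;
* §2 **`hodgeLocusOfNormLe_eq_univ_or_finite_of_cover_of_compactification`** — the same with the cover a punctured compact curve;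
* §3 **`determinationLocus_eq_univ_or_finite_of_cover_of_compactification`** — COR 1.3 (`r = 1`) through a surjective COVERING map (Mathlib
  `IsCoveringMap`) whose source is a punctured compact curve: `Motives/FamiliesVHSComapCovering`
  (`determinationLocus_eq_univ_or_finite_of_comap_covering`) composed with `determinationLocus_eq_univ_or_finite_of_compactification` for `f* D`.

HONEST SCOPE: the existence of a finite étale cover with unipotent local monodromies (monodromy trivial mod `k ≥ 3`), the manifold∕compactification
structure and the period charts are hypotheses; `dim S = 1`.

## References

* [CattaniDeligneKaplan1995] E. Cattani, P. Deligne, A. Kaplan, *On the locus of Hodge classes*, J. Amer. Math. Soc. 8 (1995) 483–506: Thm. 1.1,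
  Cor. 1.2, Cor. 1.3 (p. 484), «Proof of 1.5 ⟹ 1.1» (p. 485), 2.3 (p. 487).
* [Schmid1973] W. Schmid, *Variation of Hodge structure: the singularities of the period mapping*, Invent. Math. 22 (1973): (4.12) (cite only).
-/

noncomputable section

open scoped TensorProduct ComplexOrder
open _root_.Topology _root_.Filter Set

namespace Literature.AlgebraicGeometry

open Module
open Motives Motives.MixedHodgeStructure Motives.HodgeStructure
open Motives.HodgeStructure (conj ofRat ofRat_apply conj_ofRat)
open HodgeTheory

universe u

namespace Motives.VHSData

variable {S : Type} [TopologicalSpace S] {S' : Type} [TopologicalSpace S'] {k : ℤ} (D : VHSData S k) (f : C(S', S))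
variable {V : Type u} [AddCommGroup V] [Module ℚ V] [FiniteDimensional ℚ V]
variable {X : Type*} [TopologicalSpace X] [CompactSpace X]

/-! ## §1 Theorem 1.1 (`r = 1`) through a surjective cover carrying the period charts -/

/-- **Cattani–Deligne–Kaplan, THEOREM 1.1 / COROLLARY 1.2 (`r = 1`) after a finite étale cover** («To prove 1.1 one is free to replace `S` of 1.1 by a
finite etale covering `S' → S` … the local monodromy of `𝒱` at infinity is unipotent»): `D : VHSData S k` (`k = p + p`), `f : S' → S` continuous and
SURJECTIVE with `S'` preconnected, and FOR THE PULL-BACK `f* D` on `S'`: flat interior charts with a metric comparison at every point, unipotent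
puncture charts `Lᵢ, Γᵢ, Λᵢ, σᵢ, eᵢ, A₀ᵢ`, open ends and a compact core (the hypotheses of `hodgeLocusOfNormLe_eq_univ_or_finite` for `f* D`).  Then
**`hodgeLocusOfNormLe D p K` is ALL of `S` or FINITE.** [cite: CattaniDeligneKaplan1995, Thm. 1.1, Cor. 1.2 (p. 484) and «Proof of 1.5 ⟹ 1.1» (p. 485)]
[cite: Schmid1973, (4.12) (cite only)] -/
theorem hodgeLocusOfNormLe_eq_univ_or_finite_of_cover [PreconnectedSpace S'] (hf : Function.Surjective f) {p : ℤ} (hpk : p + p = k) (K : ℤ)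
    -- interior charts at every point of the cover
    (hint : ∀ x : S', ∃ ψ : OpenPartialHomeomorph S' ℂ, x ∈ ψ.source ∧ IsPreconnected ψ.target ∧
      ∃ (e : ∀ c : ℂ, (D.comap f).V.fiber (ψ.symm c) ≃ₗ[ℚ] V) (H₀ : HodgeStructure V k) (P₀ : H₀.Polarization)
        (h : ℂ → Module.End ℂ (ℂ ⊗[ℚ] V)) (Λ₀ : Submodule ℤ V) (κ : ℝ),
        (∀ (φ : Module.Dual ℂ (ℂ ⊗[ℚ] V)) (w : ℂ ⊗[ℚ] V), AnalyticOnNhd ℂ (fun c => φ (h c w)) ψ.target) ∧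
        (∀ c ∈ ψ.target, (((D.comap f).hodge (ψ.symm c)).F p).map ((e c).toLinearMap.baseChange ℂ) = (H₀.F p).comap (h c)) ∧
        (∀ c ∈ ψ.target, ∀ x y : (D.comap f).V.fiber (ψ.symm c), ((D.comap f).form (ψ.symm c)).form x y = P₀.form (e c x) (e c y)) ∧
        Λ₀.FG ∧ (∀ c ∈ ψ.target, ∀ u : (D.comap f).VZ.fiber (ψ.symm c), e c ((D.comap f).toRat (ψ.symm c) u) ∈ Λ₀) ∧
        (∀ c ∈ ψ.target, ∀ v ∈ Λ₀, ∃ u : (D.comap f).VZ.fiber (ψ.symm c), e c ((D.comap f).toRat (ψ.symm c) u) = v) ∧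
        0 < κ ∧ (∀ c ∈ ψ.target, ∀ x : (D.comap f).V.fiber (ψ.symm c),
          κ * P₀.hodgeNorm (ofRat (e c x)) ≤ ((D.comap f).form (ψ.symm c)).hodgeNorm (ofRat x)))
    -- puncture charts of the cover (unipotent local monodromy)
    {ι : Type*} (L : ι → PolarizedLimitMixedHodgeStructure V k) (Γ : ι → ℂ → Module.End ℂ (ℂ ⊗[ℚ] V)) (hΓ0 : ∀ i, Γ i 0 = 0)
    (hΓan : ∀ (i : ι) (φ : Module.Dual ℂ (ℂ ⊗[ℚ] V)) (w : ℂ ⊗[ℚ] V), AnalyticAt ℂ (fun s => φ (Γ i s w)) 0)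
    (hΓb : ∀ (i : ι) (s : ℂ), Γ i s ∈ ⨆ ab ∈ {ab : ℤ × ℤ | ab.1 ≤ -1}, (L i).toMixedHodgeStructure.endPiece ab.1 ab.2)
    (Λ : ι → Submodule ℤ V) (hΛ : ∀ i, (Λ i).FG) (hΛT : ∀ i, ∀ u ∈ Λ i, (L i).monodromy u ∈ Λ i)
    (σ : ι → ℂ → S') (e : ∀ (i : ι) (z : ℂ), (D.comap f).V.fiber (σ i z) ≃ₗ[ℚ] V) (A₀ : ι → ℝ)
    (hF : ∀ (i : ι) (z : ℂ), A₀ i ≤ z.im → (((D.comap f).hodge (σ i z)).F p).map ((e i z).toLinearMap.baseChange ℂ) =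
      (((L i).F p).map (IsNilpotent.exp (Γ i (Complex.exp (2 * Real.pi * Complex.I * z))))).map (IsNilpotent.exp (z • (L i).N.baseChange ℂ)))
    (hQ : ∀ (i : ι) (z : ℂ), A₀ i ≤ z.im → ∀ x y : (D.comap f).V.fiber (σ i z),
      ((D.comap f).form (σ i z)).form x y = (L i).Q (e i z x) (e i z y))
    (hΛ₁ : ∀ (i : ι) (z : ℂ), A₀ i ≤ z.im → ∀ u : (D.comap f).VZ.fiber (σ i z), e i z ((D.comap f).toRat (σ i z) u) ∈ Λ i)
    (hΛ₂ : ∀ (i : ι) (z : ℂ), A₀ i ≤ z.im → ∀ v ∈ Λ i, ∃ u : (D.comap f).VZ.fiber (σ i z), e i z ((D.comap f).toRat (σ i z) u) = v)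
    (hopen : ∀ (i : ι) (A : ℝ), A₀ i ≤ A → IsOpen (σ i '' {z : ℂ | A < z.im}))
    (hcore : ∀ A : ι → ℝ, (∀ i, A₀ i ≤ A i) → ∃ C : Set S', IsCompact C ∧ C ∪ ⋃ i, σ i '' {z : ℂ | A i < z.im} = univ) :
    D.hodgeLocusOfNormLe p K = univ ∨ (D.hodgeLocusOfNormLe p K).Finite :=
  D.hodgeLocusOfNormLe_eq_univ_or_finite_of_comap f hf
    ((D.comap f).hodgeLocusOfNormLe_eq_univ_or_finite hpk K hint L Γ hΓ0 hΓan hΓb Λ hΛ hΛT σ e A₀ hF hQ hΛ₁ hΛ₂ hopen hcore)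

/-! ## §2 Theorem 1.1 (`r = 1`) through a surjective cover by a punctured compact curve -/

/-- **THEOREM 1.1 / COROLLARY 1.2 (`r = 1`) after a finite étale cover by a PUNCTURED COMPACT CURVE** («replace `S` by a finite etale covering `S' → S` …
Let `S̄` be a smooth compactification … in a neighborhood of any point in `S̄ − S`, one is in the situation considered in 1.5»): as in §1, the open
ends and compact core of the cover `S'` supplied by an embedding `j : S' → X` into a compact `X` with disc charts `φ i` centred at the punctures
`pt i` and `j (σ i z) = (φ i)⁻¹(e^{2πiz})`.  Then **`hodgeLocusOfNormLe D p K` is ALL of `S` or FINITE.**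
[cite: CattaniDeligneKaplan1995, Thm. 1.1, Cor. 1.2 (p. 484), «Proof of 1.5 ⟹ 1.1» (p. 485), 2.3 (p. 487)] [cite: Schmid1973, (4.12) (cite only)] -/
theorem hodgeLocusOfNormLe_eq_univ_or_finite_of_cover_of_compactification [PreconnectedSpace S'] (hf : Function.Surjective f) {p : ℤ}
    (hpk : p + p = k) (K : ℤ)
    -- interior charts at every point of the cover
    (hint : ∀ x : S', ∃ ψ : OpenPartialHomeomorph S' ℂ, x ∈ ψ.source ∧ IsPreconnected ψ.target ∧
      ∃ (e : ∀ c : ℂ, (D.comap f).V.fiber (ψ.symm c) ≃ₗ[ℚ] V) (H₀ : HodgeStructure V k) (P₀ : H₀.Polarization)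
        (h : ℂ → Module.End ℂ (ℂ ⊗[ℚ] V)) (Λ₀ : Submodule ℤ V) (κ : ℝ),
        (∀ (φ : Module.Dual ℂ (ℂ ⊗[ℚ] V)) (w : ℂ ⊗[ℚ] V), AnalyticOnNhd ℂ (fun c => φ (h c w)) ψ.target) ∧
        (∀ c ∈ ψ.target, (((D.comap f).hodge (ψ.symm c)).F p).map ((e c).toLinearMap.baseChange ℂ) = (H₀.F p).comap (h c)) ∧
        (∀ c ∈ ψ.target, ∀ x y : (D.comap f).V.fiber (ψ.symm c), ((D.comap f).form (ψ.symm c)).form x y = P₀.form (e c x) (e c y)) ∧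
        Λ₀.FG ∧ (∀ c ∈ ψ.target, ∀ u : (D.comap f).VZ.fiber (ψ.symm c), e c ((D.comap f).toRat (ψ.symm c) u) ∈ Λ₀) ∧
        (∀ c ∈ ψ.target, ∀ v ∈ Λ₀, ∃ u : (D.comap f).VZ.fiber (ψ.symm c), e c ((D.comap f).toRat (ψ.symm c) u) = v) ∧
        0 < κ ∧ (∀ c ∈ ψ.target, ∀ x : (D.comap f).V.fiber (ψ.symm c),
          κ * P₀.hodgeNorm (ofRat (e c x)) ≤ ((D.comap f).form (ψ.symm c)).hodgeNorm (ofRat x)))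
    -- puncture charts of the cover (unipotent local monodromy)
    {ι : Type*} (L : ι → PolarizedLimitMixedHodgeStructure V k) (Γ : ι → ℂ → Module.End ℂ (ℂ ⊗[ℚ] V)) (hΓ0 : ∀ i, Γ i 0 = 0)
    (hΓan : ∀ (i : ι) (φ : Module.Dual ℂ (ℂ ⊗[ℚ] V)) (w : ℂ ⊗[ℚ] V), AnalyticAt ℂ (fun s => φ (Γ i s w)) 0)
    (hΓb : ∀ (i : ι) (s : ℂ), Γ i s ∈ ⨆ ab ∈ {ab : ℤ × ℤ | ab.1 ≤ -1}, (L i).toMixedHodgeStructure.endPiece ab.1 ab.2)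
    (Λ : ι → Submodule ℤ V) (hΛ : ∀ i, (Λ i).FG) (hΛT : ∀ i, ∀ u ∈ Λ i, (L i).monodromy u ∈ Λ i)
    (σ : ι → ℂ → S') (e : ∀ (i : ι) (z : ℂ), (D.comap f).V.fiber (σ i z) ≃ₗ[ℚ] V) (A₀ : ι → ℝ)
    (hF : ∀ (i : ι) (z : ℂ), A₀ i ≤ z.im → (((D.comap f).hodge (σ i z)).F p).map ((e i z).toLinearMap.baseChange ℂ) =
      (((L i).F p).map (IsNilpotent.exp (Γ i (Complex.exp (2 * Real.pi * Complex.I * z))))).map (IsNilpotent.exp (z • (L i).N.baseChange ℂ)))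
    (hQ : ∀ (i : ι) (z : ℂ), A₀ i ≤ z.im → ∀ x y : (D.comap f).V.fiber (σ i z),
      ((D.comap f).form (σ i z)).form x y = (L i).Q (e i z x) (e i z y))
    (hΛ₁ : ∀ (i : ι) (z : ℂ), A₀ i ≤ z.im → ∀ u : (D.comap f).VZ.fiber (σ i z), e i z ((D.comap f).toRat (σ i z) u) ∈ Λ i)
    (hΛ₂ : ∀ (i : ι) (z : ℂ), A₀ i ≤ z.im → ∀ v ∈ Λ i, ∃ u : (D.comap f).VZ.fiber (σ i z), e i z ((D.comap f).toRat (σ i z) u) = v)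
    -- the compactification of the cover with disc charts at its punctures
    {j : S' → X} (hj : IsEmbedding j) (pt : ι → X) (hpS : ∀ i, pt i ∉ range j) (hcov : ∀ x : X, x ∉ range j → ∃ i, x = pt i)
    (φ : ι → OpenPartialHomeomorph X ℂ) (hp : ∀ i, pt i ∈ (φ i).source) (hφp : ∀ i, φ i (pt i) = 0)
    (hball : ∀ i, Metric.ball (0 : ℂ) (Real.exp (-(2 * Real.pi * A₀ i))) ⊆ (φ i).target)
    (hσ : ∀ (i : ι) (z : ℂ), A₀ i < z.im → j (σ i z) = (φ i).symm (Complex.exp (2 * Real.pi * Complex.I * z))) :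
    D.hodgeLocusOfNormLe p K = univ ∨ (D.hodgeLocusOfNormLe p K).Finite :=
  D.hodgeLocusOfNormLe_eq_univ_or_finite_of_comap f hf
    ((D.comap f).hodgeLocusOfNormLe_eq_univ_or_finite_of_compactification hpk K hint L Γ hΓ0 hΓan hΓb Λ hΛ hΛT σ e A₀ hF hQ hΛ₁ hΛ₂ hj
      pt hpS hcov φ hp hφp hball hσ)

/-! ## §3 Corollary 1.3 (`r = 1`) through a surjective covering map from a punctured compact curve -/

/-- **Cattani–Deligne–Kaplan, COROLLARY 1.3 (`r = 1`) after a finite étale cover by a punctured compact curve**: `f : S' → S` a SURJECTIVE COVERING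
MAP (Mathlib `IsCoveringMap`; paths lift), `s'₀ ∈ S'`, `u₀ ∈ V_ℤ,f(s'₀)`; the flat interior charts and flat unipotent puncture charts of
`determinationLocus_eq_univ_or_finite` FOR `f* D` on `S'`, the open ends and compact core of `S'` from a compactification with disc charts.  Then
**the set of `t ∈ S` where SOME determination `γ · u₀` (`γ : f s'₀ ⇝ t`) is of type `(p, p)` is ALL of `S` or FINITE** (it is the image under `f` of the
determination locus of `u₀` for `f* D`, `Motives/FamiliesVHSComapCovering`). [cite: CattaniDeligneKaplan1995, Cor. 1.3 (p. 484), «Proof of 1.5 ⟹ 1.1» (p. 485), 2.3 (p. 487)]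
[cite: Schmid1973, (4.12) (cite only)] -/
theorem determinationLocus_eq_univ_or_finite_of_cover_of_compactification [PreconnectedSpace S'] (hf : IsCoveringMap f)
    (hsurj : Function.Surjective f) {p : ℤ} (hpk : p + p = k) {s'₀ : S'} (u₀ : D.VZ.fiber (f s'₀))
    -- flat interior charts at every point of the cover
    (hint : ∀ x : S', ∃ ψ : OpenPartialHomeomorph S' ℂ, x ∈ ψ.source ∧ IsPreconnected ψ.target ∧
      ∃ (e : ∀ c : ℂ, (D.comap f).V.fiber (ψ.symm c) ≃ₗ[ℚ] V) (H₀ : HodgeStructure V k) (P₀ : H₀.Polarization)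
        (h : ℂ → Module.End ℂ (ℂ ⊗[ℚ] V)) (Λ₀ : Submodule ℤ V) (κ : ℝ),
        (∀ (φ : Module.Dual ℂ (ℂ ⊗[ℚ] V)) (w : ℂ ⊗[ℚ] V), AnalyticOnNhd ℂ (fun c => φ (h c w)) ψ.target) ∧
        (∀ c ∈ ψ.target, (((D.comap f).hodge (ψ.symm c)).F p).map ((e c).toLinearMap.baseChange ℂ) = (H₀.F p).comap (h c)) ∧
        Λ₀.FG ∧ (∀ c ∈ ψ.target, ∀ u : (D.comap f).VZ.fiber (ψ.symm c), e c ((D.comap f).toRat (ψ.symm c) u) ∈ Λ₀) ∧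
        0 < κ ∧ (∀ c ∈ ψ.target, ∀ x : (D.comap f).V.fiber (ψ.symm c),
          κ * P₀.hodgeNorm (ofRat (e c x)) ≤ ((D.comap f).form (ψ.symm c)).hodgeNorm (ofRat x)) ∧
        (∀ c ∈ ψ.target, ∀ c' ∈ ψ.target, ∃ δ : Path.Homotopic.Quotient (ψ.symm c) (ψ.symm c'),
          ∀ y : (D.comap f).V.fiber (ψ.symm c), e c' ((D.comap f).V.transport δ y) = e c y))
    -- flat puncture charts of the cover (unipotent local monodromy)
    {ι : Type*} (L : ι → PolarizedLimitMixedHodgeStructure V k) (Γ : ι → ℂ → Module.End ℂ (ℂ ⊗[ℚ] V)) (hΓ0 : ∀ i, Γ i 0 = 0)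
    (hΓan : ∀ (i : ι) (φ : Module.Dual ℂ (ℂ ⊗[ℚ] V)) (w : ℂ ⊗[ℚ] V), AnalyticAt ℂ (fun s => φ (Γ i s w)) 0)
    (hΓb : ∀ (i : ι) (s : ℂ), Γ i s ∈ ⨆ ab ∈ {ab : ℤ × ℤ | ab.1 ≤ -1}, (L i).toMixedHodgeStructure.endPiece ab.1 ab.2)
    (Λ : ι → Submodule ℤ V) (hΛ : ∀ i, (Λ i).FG) (hΛT : ∀ i, ∀ u ∈ Λ i, (L i).monodromy u ∈ Λ i)
    (σ : ι → ℂ → S') (e : ∀ (i : ι) (z : ℂ), (D.comap f).V.fiber (σ i z) ≃ₗ[ℚ] V) (A₀ : ι → ℝ)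
    (hF : ∀ (i : ι) (z : ℂ), A₀ i ≤ z.im → (((D.comap f).hodge (σ i z)).F p).map ((e i z).toLinearMap.baseChange ℂ) =
      (((L i).F p).map (IsNilpotent.exp (Γ i (Complex.exp (2 * Real.pi * Complex.I * z))))).map (IsNilpotent.exp (z • (L i).N.baseChange ℂ)))
    (hQ : ∀ (i : ι) (z : ℂ), A₀ i ≤ z.im → ∀ x y : (D.comap f).V.fiber (σ i z),
      ((D.comap f).form (σ i z)).form x y = (L i).Q (e i z x) (e i z y))
    (hΛ₁ : ∀ (i : ι) (z : ℂ), A₀ i ≤ z.im → ∀ u : (D.comap f).VZ.fiber (σ i z), e i z ((D.comap f).toRat (σ i z) u) ∈ Λ i)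
    (hflat : ∀ (i : ι) (z z' : ℂ), A₀ i ≤ z.im → A₀ i ≤ z'.im → ∃ δ : Path.Homotopic.Quotient (σ i z) (σ i z'),
      ∀ y : (D.comap f).V.fiber (σ i z), e i z' ((D.comap f).V.transport δ y) = e i z y)
    -- the compactification of the cover with disc charts at its punctures
    {j : S' → X} (hj : IsEmbedding j) (pt : ι → X) (hpS : ∀ i, pt i ∉ range j) (hcov : ∀ x : X, x ∉ range j → ∃ i, x = pt i)
    (φ : ι → OpenPartialHomeomorph X ℂ) (hp : ∀ i, pt i ∈ (φ i).source) (hφp : ∀ i, φ i (pt i) = 0)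
    (hball : ∀ i, Metric.ball (0 : ℂ) (Real.exp (-(2 * Real.pi * A₀ i))) ⊆ (φ i).target)
    (hσ : ∀ (i : ι) (z : ℂ), A₀ i < z.im → j (σ i z) = (φ i).symm (Complex.exp (2 * Real.pi * Complex.I * z))) :
    {t : S | ∃ γ : Path.Homotopic.Quotient (f s'₀) t, D.IsHodgeAt t p (D.VZ.transport γ u₀)} = univ ∨
      {t : S | ∃ γ : Path.Homotopic.Quotient (f s'₀) t, D.IsHodgeAt t p (D.VZ.transport γ u₀)}.Finite :=
  D.determinationLocus_eq_univ_or_finite_of_comap_covering hf hsurj u₀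
    ((D.comap f).determinationLocus_eq_univ_or_finite_of_compactification hpk u₀ hint L Γ hΓ0 hΓan hΓb Λ hΛ hΛT σ e A₀ hF hQ hΛ₁ hflat hj
      pt hpS hcov φ hp hφp hball hσ)

end Motives.VHSData

end Literature.AlgebraicGeometry

end
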